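import Mathlib
import HarnessLib
import Summits.NavierStokesRegularity.NavierStokesRegularity.Theorems.PoloidalWindowDoorLrcModEntireTHCertGaugeRS

/-!
# Route `PoloidalWindowDoor`, item `LrcModEntire` (stmt-NavierStokesRegularity-20428) — certificate wiring: the CO-MOVING gauge as POINT-ZERO LETTERS
# (the rest worldline `u(s, x₀) = 0`, `s` near `t₀`, kills every pure time jet `∂ₜ^τ u_i (p₀)` of the Cartesian (TH) datum)

Cell ns-regularity-ideate, seat ns-k2-port-2 g2 (kernel-port lineage under the LEAD of item 20428, ns-poloidal-K2-p3 g11; `--supports stmt-NavierStokesRegularity-20428`).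
Sequel of `…THCertGauge` (Galilean zeros `[u₂, u₀, u₁]`) / `…THCertGaugeRS` (+ `∂₀u₂ = 0`, value `∂₁u₂ = 1`) and of `…TwistingTHLocalComoving.localTHEmptyHypNUGRS_of_comoving`
(the registered statement may assume the rest WORLDLINE `∀ᶠ s in 𝓝 p₀.1, u s p₀.2 = 0`).  In the co-moving frame of the LEAD's dynamic rows (`Cruxes/LrcModEntire/
DYNAMIC-ROWS-g11.md` §2) the frame row `G0` and its time derivatives say exactly that the letters `W i τ 0 0 0 = ∂ₜ^τ u_i` VANISH AT `p₀` for every `τ`; here: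

* `jetLetter_time_eventually_eq_zero` / `jetLetter_time_eq_zero` — for `F` analytic on an open `V ∋ p₀` with `F(s, p₀.2) = 0` for `s` near `p₀.1`, every iterated
  time derivative `jetLetter F (replicate τ (1,0)) p₀` vanishes (induction: the time letter of a function vanishing on the worldline vanishes on the worldline);
* `gaugeZerosC L` = `gaugeZeros L ++` the indices of `W i τ 0 0 0`, `τ = 1, 2, 3`, `i = 2, 0, 1` (letters absent from `L` get index `L.length`, harmless);
  `gaugeZerosRSC L` = the same after `gaugeZerosRS L`;
* `thLocalDatumZC` / `thLocalDatumZVC` — **the (TH) local datum with the Galilean (resp. RS) gauge AND the co-moving time-jet zeros**, from the hypotheses of the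
  registered stub plus the worldline hypothesis;
* the by-name closers (composition with `…TwistingTHLocalComoving.localTHEmptyHypNUGRS_of_comoving`) in the time-jet slice letters of `…THCertSliceUD8T`
  are the sequel `…THCertSliceGaugeUD8TC`.

WHAT THIS IS NOT: not a claim about Navier–Stokes and not a certificate — plumbing. [folklore]
-/

noncomputable section

-- the summit and its single sub-problem share the name (CONVENTIONS §1), as in every Theorems file
set_option linter.dupNamespace false

namespace Summit.NavierStokesRegularity.NavierStokesRegularity.Theorems.PoloidalWindowDoorLrcModEntireTHCertGaugeComoving

open _root_.Topology _root_.Filter Set Function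
open scoped InnerProductSpace Laplacian
open Literature.Analysis.ValidatedNumerics
open Summit.NavierStokesRegularity.NavierStokesRegularity.Theorems.PoloidalWindowDoorLrcModEntireJetCertDefs
open Summit.NavierStokesRegularity.NavierStokesRegularity.Theorems.PoloidalWindowDoorLrcModEntireJetCertTree
open Summit.NavierStokesRegularity.NavierStokesRegularity.Theorems.PoloidalWindowDoorLrcModEntireJetCertFast2
open Summit.NavierStokesRegularity.NavierStokesRegularity.Theorems.PoloidalWindowDoorLrcModEntireJetCertGauge
open Summit.NavierStokesRegularity.NavierStokesRegularity.Theorems.PoloidalWindowDoorLrcModEntireJetCertGaugeV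
open Summit.NavierStokesRegularity.NavierStokesRegularity.Theorems.PoloidalWindowDoorLrcModEntireJetLetters
open Summit.NavierStokesRegularity.NavierStokesRegularity.Theorems.PoloidalWindowDoorLrcModEntireTHCertLetters
open Summit.NavierStokesRegularity.NavierStokesRegularity.Theorems.PoloidalWindowDoorLrcModEntireTHCertDictionary
open Summit.NavierStokesRegularity.NavierStokesRegularity.Theorems.PoloidalWindowDoorLrcModEntireTHCert
open Summit.NavierStokesRegularity.NavierStokesRegularity.Theorems.PoloidalWindowDoorLrcModEntireTHCertSteady
open Summit.NavierStokesRegularity.NavierStokesRegularity.Theorems.PoloidalWindowDoorLrcModEntireTHCertGauge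
open Summit.NavierStokesRegularity.NavierStokesRegularity.Theorems.PoloidalWindowDoorLrcModEntireTHCertGaugeRS

/-! ### Time jets of a function vanishing on the worldline -/

/-- **A function analytic near the worldline `{(s, x₀)}` and vanishing on it has all its iterated time derivatives vanishing on it** (eventual form,
for the induction). [folklore] -/
theorem jetLetter_time_eventually_eq_zero {F : ℝ × EuclideanSpace ℝ (Fin 3) → ℝ} {V : Set (ℝ × EuclideanSpace ℝ (Fin 3))} (hV : IsOpen V)
    (hF : AnalyticOnNhd ℝ F V) {p₀ : ℝ × EuclideanSpace ℝ (Fin 3)} (hp₀ : p₀ ∈ V) (h0 : ∀ᶠ s in 𝓝 p₀.1, F (s, p₀.2) = 0) :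
    ∀ τ : ℕ, ∀ᶠ s in 𝓝 p₀.1, jetLetter F (List.replicate τ (((1 : ℝ), (0 : EuclideanSpace ℝ (Fin 3))))) (s, p₀.2) = 0 := by
  -- the worldline stays in `V` for `s` near `p₀.1`
  have hline : ∀ᶠ s in 𝓝 p₀.1, ((s, p₀.2) : ℝ × EuclideanSpace ℝ (Fin 3)) ∈ V := by
    have hc : ContinuousAt (fun s : ℝ => ((s, p₀.2) : ℝ × EuclideanSpace ℝ (Fin 3))) p₀.1 := by fun_prop
    exact hc.preimage_mem_nhds (hV.mem_nhds (by simpa using hp₀))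
  intro τ
  induction τ with
  | zero => simpa using h0
  | succ τ ih =>
    -- near `p₀.1`: the previous letter vanishes on a whole neighbourhood and is differentiable there
    filter_upwards [ih.eventually_nhds, hline] with s hs hsV
    rw [List.replicate_succ, jetLetter_cons]
    dsimp only
    have hd : DifferentiableAt ℝ (jetLetter F (List.replicate τ ((1 : ℝ), (0 : EuclideanSpace ℝ (Fin 3))))) (s, p₀.2) :=
      (analyticOnNhd_jetLetter hF _ _ hsV).differentiableAt
    rw [← deriv_spacetime_time (p := (s, p₀.2)) hd]
    have hev : (fun r => jetLetter F (List.replicate τ ((1 : ℝ), (0 : EuclideanSpace ℝ (Fin 3)))) (r, p₀.2)) =ᶠ[𝓝 s]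
        fun _ => (0 : ℝ) := hs
    rw [hev.deriv_eq]
    simp

/-- The same at the base point. [folklore] -/
theorem jetLetter_time_eq_zero {F : ℝ × EuclideanSpace ℝ (Fin 3) → ℝ} {V : Set (ℝ × EuclideanSpace ℝ (Fin 3))} (hV : IsOpen V)
    (hF : AnalyticOnNhd ℝ F V) {p₀ : ℝ × EuclideanSpace ℝ (Fin 3)} (hp₀ : p₀ ∈ V) (h0 : ∀ᶠ s in 𝓝 p₀.1, F (s, p₀.2) = 0) (τ : ℕ) :
    jetLetter F (List.replicate τ (((1 : ℝ), (0 : EuclideanSpace ℝ (Fin 3))))) p₀ = 0 := by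
  have h := (jetLetter_time_eventually_eq_zero hV hF hp₀ h0 τ).self_of_nhds
  simpa using h

/-- **The pure time letters `W i τ 0 0 0 = ∂ₜ^τ u_i` vanish at `p₀` on the rest worldline.** [folklore] -/
theorem letterFn_W_time_eq_zero {u : ℝ → EuclideanSpace ℝ (Fin 3) → EuclideanSpace ℝ (Fin 3)} {μ A : ℝ → ℝ → ℝ}
    {U : Set (ℝ × EuclideanSpace ℝ (Fin 3))} {p₀ : ℝ × EuclideanSpace ℝ (Fin 3)} (hU : IsOpen U) (hp₀ : p₀ ∈ U)
    (hu : AnalyticOnNhd ℝ (Function.uncurry u) U) (hline : ∀ᶠ s in 𝓝 p₀.1, u s p₀.2 = 0) (i : Fin 3) (τ : ℕ) :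
    letterFn u μ A (.W i τ 0 0 0) p₀ = 0 := by
  have h0 : ∀ᶠ s in 𝓝 p₀.1, (fun q : ℝ × EuclideanSpace ℝ (Fin 3) => u q.1 q.2 i) (s, p₀.2) = 0 := by
    filter_upwards [hline] with s hs
    simp [hs]
  have h := jetLetter_time_eq_zero hU (analyticOnNhd_comp hu i) hp₀ h0 τ
  simpa [letterFn, wordW, dirVec] using h

/-! ### The co-moving zero letters -/

/-- The point-zero letters of the Galilean gauge in the co-moving frame: `u₂, u₀, u₁` and the time jets `∂ₜ^τ u₂, ∂ₜ^τ u₀, ∂ₜ^τ u₁`, `τ = 1, 2, 3`. [folklore] -/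
def gaugeZerosC (L : List THLetter) : List ℕ :=
  gaugeZeros L ++ [L.idxOf (THLetter.W 2 1 0 0 0), L.idxOf (THLetter.W 0 1 0 0 0), L.idxOf (THLetter.W 1 1 0 0 0),
    L.idxOf (THLetter.W 2 2 0 0 0), L.idxOf (THLetter.W 0 2 0 0 0), L.idxOf (THLetter.W 1 2 0 0 0),
    L.idxOf (THLetter.W 2 3 0 0 0), L.idxOf (THLetter.W 0 3 0 0 0), L.idxOf (THLetter.W 1 3 0 0 0)]

/-- The point-zero letters of the RS gauge in the co-moving frame (`gaugeZerosRS` + the same time jets). [folklore] -/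
def gaugeZerosRSC (L : List THLetter) : List ℕ :=
  gaugeZerosRS L ++ [L.idxOf (THLetter.W 2 1 0 0 0), L.idxOf (THLetter.W 0 1 0 0 0), L.idxOf (THLetter.W 1 1 0 0 0),
    L.idxOf (THLetter.W 2 2 0 0 0), L.idxOf (THLetter.W 0 2 0 0 0), L.idxOf (THLetter.W 1 2 0 0 0),
    L.idxOf (THLetter.W 2 3 0 0 0), L.idxOf (THLetter.W 0 3 0 0 0), L.idxOf (THLetter.W 1 3 0 0 0)]

/-- A jet coordinate indexed by `L.idxOf ℓ` (with the index in range) IS the letter `ℓ`. [folklore] -/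
theorem jetMapOf_idxOf {L : List THLetter} {u : ℝ → EuclideanSpace ℝ (Fin 3) → EuclideanSpace ℝ (Fin 3)} {μ A : ℝ → ℝ → ℝ}
    (p₀ : ℝ × EuclideanSpace ℝ (Fin 3)) (ℓ : THLetter) {i : ℕ} (hi : i = L.idxOf ℓ) (hlt : i < L.length) :
    jetMapOf L u μ A p₀ ⟨i, hlt⟩ = letterFn u μ A ℓ p₀ := by
  have hmem : ℓ ∈ L := by subst hi; exact List.idxOf_lt_length_iff.1 hlt
  have hget : L[i]'hlt = ℓ := by subst hi; exact List.getElem_idxOf (List.idxOf_lt_length_iff.2 hmem)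
  rw [jetMapOf, mkJet_apply]
  show letterFn u μ A (L[(⟨i, hlt⟩ : Fin L.length)]) p₀ = _
  rw [show L[(⟨i, hlt⟩ : Fin L.length)] = L[i]'hlt from rfl, hget]

/-- The nine time-jet indices all carry a vanishing letter on the rest worldline. [folklore] -/
theorem timeZeros_vanish {L : List THLetter} {u : ℝ → EuclideanSpace ℝ (Fin 3) → EuclideanSpace ℝ (Fin 3)} {μ A : ℝ → ℝ → ℝ}
    {U : Set (ℝ × EuclideanSpace ℝ (Fin 3))} {p₀ : ℝ × EuclideanSpace ℝ (Fin 3)} (hU : IsOpen U) (hp₀ : p₀ ∈ U)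
    (hu : AnalyticOnNhd ℝ (Function.uncurry u) U) (hline : ∀ᶠ s in 𝓝 p₀.1, u s p₀.2 = 0) {i : ℕ}
    (hi : i ∈ [L.idxOf (THLetter.W 2 1 0 0 0), L.idxOf (THLetter.W 0 1 0 0 0), L.idxOf (THLetter.W 1 1 0 0 0),
      L.idxOf (THLetter.W 2 2 0 0 0), L.idxOf (THLetter.W 0 2 0 0 0), L.idxOf (THLetter.W 1 2 0 0 0),
      L.idxOf (THLetter.W 2 3 0 0 0), L.idxOf (THLetter.W 0 3 0 0 0), L.idxOf (THLetter.W 1 3 0 0 0)])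
    (hlt : i < L.length) : jetMapOf L u μ A p₀ ⟨i, hlt⟩ = 0 := by
  simp only [List.mem_cons, List.mem_nil_iff, or_false] at hi
  rcases hi with h | h | h | h | h | h | h | h | h <;>
    (rw [jetMapOf_idxOf p₀ _ h hlt]; exact letterFn_W_time_eq_zero hU hp₀ hu hline _ _)

/-! ### The gauged data in the co-moving frame -/

/-- **The (TH) local datum with the Galilean gauge and the CO-MOVING time-jet zeros**, from the hypotheses of the registered stub + the rest worldline. [folklore] -/
theorem thLocalDatumZC (L : List THLetter) (hL : lettersOK L = true)
    {u : ℝ → EuclideanSpace ℝ (Fin 3) → EuclideanSpace ℝ (Fin 3)} {μ A : ℝ → ℝ → ℝ}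
    {U : Set (ℝ × EuclideanSpace ℝ (Fin 3))} {p₀ : ℝ × EuclideanSpace ℝ (Fin 3)} (hU : IsOpen U) (hp₀ : p₀ ∈ U)
    (hu : AnalyticOnNhd ℝ (Function.uncurry u) U)
    (hμ : ∀ p ∈ U, AnalyticAt ℝ (Function.uncurry μ) (p.1, p.2 2)) (hA : ∀ p ∈ U, AnalyticAt ℝ (Function.uncurry A) (p.1, p.2 2))
    (hpol : ∀ p ∈ U, fderiv ℝ (u p.1) p.2 (EuclideanSpace.single 0 1) 1 = fderiv ℝ (u p.1) p.2 (EuclideanSpace.single 1 1) 0)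
    (hdiv : ∀ p ∈ U, fderiv ℝ (u p.1) p.2 (EuclideanSpace.single 0 1) 0 + fderiv ℝ (u p.1) p.2 (EuclideanSpace.single 1 1) 1 +
      fderiv ℝ (u p.1) p.2 (EuclideanSpace.single 2 1) 2 = 0)
    (hsh : ∀ p ∈ U, ∀ b : Fin 3, b ≠ 2 →
      fderiv ℝ (u p.1) p.2 (EuclideanSpace.single 2 1) b = μ p.1 (p.2 2) * fderiv ℝ (u p.1) p.2 (EuclideanSpace.single b 1) 2)
    (hE : ∀ p ∈ U,
      (1 - μ p.1 (p.2 2)) *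
          (deriv (fun s => u s p.2 2) p.1 + fderiv ℝ (fun y => u p.1 y 2) p.2 (u p.1 p.2) - Δ (fun y => u p.1 y 2) p.2) =
        A p.1 (p.2 2) + (deriv (fun s => μ s (p.2 2)) p.1 - deriv (deriv (μ p.1)) (p.2 2)) * u p.1 p.2 2
          + deriv (μ p.1) (p.2 2) / 2 * u p.1 p.2 2 ^ 2 - 2 * deriv (μ p.1) (p.2 2) * fderiv ℝ (u p.1) p.2 (EuclideanSpace.single 2 1) 2)
    (htw : fderiv ℝ (fun y => fderiv ℝ (u p₀.1) y (EuclideanSpace.single 2 1) 2) p₀.2 (EuclideanSpace.single 0 1) *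
            fderiv ℝ (u p₀.1) p₀.2 (EuclideanSpace.single 1 1) 2 -
          fderiv ℝ (fun y => fderiv ℝ (u p₀.1) y (EuclideanSpace.single 2 1) 2) p₀.2 (EuclideanSpace.single 1 1) *
            fderiv ℝ (u p₀.1) p₀.2 (EuclideanSpace.single 0 1) 2 ≠ 0)
    (hm0 : μ p₀.1 (p₀.2 2) ≠ 0) (hm1 : μ p₀.1 (p₀.2 2) ≠ 1) (hmz : deriv (μ p₀.1) (p₀.2 2) ≠ 0)
    (hNU : fderiv ℝ (u p₀.1) p₀.2 (EuclideanSpace.single 0 1) 0 ≠ fderiv ℝ (u p₀.1) p₀.2 (EuclideanSpace.single 1 1) 1 ∨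
      fderiv ℝ (u p₀.1) p₀.2 (EuclideanSpace.single 1 1) 0 ≠ 0)
    (hrest : u p₀.1 p₀.2 = 0) (hline : ∀ᶠ s in 𝓝 p₀.1, u s p₀.2 = 0) :
    LocalDatumZ (E := ℝ × EuclideanSpace ℝ (Fin 3)) L.length (tableOf L) (maskOf L) dirVec (thHyps L) (thPins L ++ [pinNonUmbilic L]) (gaugeZerosC L) := by
  -- built with the NAMED jet map `jetMapOf`, exactly as `…THCertGauge.thLocalDatumZ`, plus the nine time-jet point facts
  refine ⟨U, p₀, jetMapOf L u μ A, hU, hp₀, fun _ hq => differentiableAt_jetMapOf hu hμ hA hq,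
    fun j i hi _ hq => tables_jetMapOf hU hu hμ hA j i hi hq, thHyps_vanish hL hU hu hμ hpol hdiv hsh hE, ?_, ?_⟩
  · intro π hπ
    rcases List.mem_append.1 hπ with h | h
    · exact thPins_ne_zero hL hU hu hμ hp₀ htw hm0 hm1 hmz π h
    · simp only [List.mem_cons, List.mem_nil_iff, or_false] at h
      subst h
      exact pinNonUmbilic_ne_zero hL hu hp₀ hNU
  · intro i hi hlt
    rcases List.mem_append.1 hi with h | h
    · simp only [gaugeZeros, List.mem_cons, List.mem_nil_iff, or_false] at h
      rcases h with h | h | h <;> (rw [jetMapOf_idxOf p₀ _ h hlt, letterFn_W0, hrest]; rfl)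
    · exact timeZeros_vanish hU hp₀ hu hline h hlt

/-- **The (TH) local datum with the RS gauge (zeros + value) and the CO-MOVING time-jet zeros.** [folklore] -/
theorem thLocalDatumZVC (L : List THLetter) (hL : lettersOK L = true)
    {u : ℝ → EuclideanSpace ℝ (Fin 3) → EuclideanSpace ℝ (Fin 3)} {μ A : ℝ → ℝ → ℝ}
    {U : Set (ℝ × EuclideanSpace ℝ (Fin 3))} {p₀ : ℝ × EuclideanSpace ℝ (Fin 3)} (hU : IsOpen U) (hp₀ : p₀ ∈ U)
    (hu : AnalyticOnNhd ℝ (Function.uncurry u) U)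
    (hμ : ∀ p ∈ U, AnalyticAt ℝ (Function.uncurry μ) (p.1, p.2 2)) (hA : ∀ p ∈ U, AnalyticAt ℝ (Function.uncurry A) (p.1, p.2 2))
    (hpol : ∀ p ∈ U, fderiv ℝ (u p.1) p.2 (EuclideanSpace.single 0 1) 1 = fderiv ℝ (u p.1) p.2 (EuclideanSpace.single 1 1) 0)
    (hdiv : ∀ p ∈ U, fderiv ℝ (u p.1) p.2 (EuclideanSpace.single 0 1) 0 + fderiv ℝ (u p.1) p.2 (EuclideanSpace.single 1 1) 1 +
      fderiv ℝ (u p.1) p.2 (EuclideanSpace.single 2 1) 2 = 0)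
    (hsh : ∀ p ∈ U, ∀ b : Fin 3, b ≠ 2 →
      fderiv ℝ (u p.1) p.2 (EuclideanSpace.single 2 1) b = μ p.1 (p.2 2) * fderiv ℝ (u p.1) p.2 (EuclideanSpace.single b 1) 2)
    (hE : ∀ p ∈ U,
      (1 - μ p.1 (p.2 2)) *
          (deriv (fun s => u s p.2 2) p.1 + fderiv ℝ (fun y => u p.1 y 2) p.2 (u p.1 p.2) - Δ (fun y => u p.1 y 2) p.2) =
        A p.1 (p.2 2) + (deriv (fun s => μ s (p.2 2)) p.1 - deriv (deriv (μ p.1)) (p.2 2)) * u p.1 p.2 2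
          + deriv (μ p.1) (p.2 2) / 2 * u p.1 p.2 2 ^ 2 - 2 * deriv (μ p.1) (p.2 2) * fderiv ℝ (u p.1) p.2 (EuclideanSpace.single 2 1) 2)
    (htw : fderiv ℝ (fun y => fderiv ℝ (u p₀.1) y (EuclideanSpace.single 2 1) 2) p₀.2 (EuclideanSpace.single 0 1) *
            fderiv ℝ (u p₀.1) p₀.2 (EuclideanSpace.single 1 1) 2 -
          fderiv ℝ (fun y => fderiv ℝ (u p₀.1) y (EuclideanSpace.single 2 1) 2) p₀.2 (EuclideanSpace.single 1 1) *
            fderiv ℝ (u p₀.1) p₀.2 (EuclideanSpace.single 0 1) 2 ≠ 0)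
    (hm0 : μ p₀.1 (p₀.2 2) ≠ 0) (hm1 : μ p₀.1 (p₀.2 2) ≠ 1) (hmz : deriv (μ p₀.1) (p₀.2 2) ≠ 0)
    (hNU : fderiv ℝ (u p₀.1) p₀.2 (EuclideanSpace.single 0 1) 0 ≠ fderiv ℝ (u p₀.1) p₀.2 (EuclideanSpace.single 1 1) 1 ∨
      fderiv ℝ (u p₀.1) p₀.2 (EuclideanSpace.single 1 1) 0 ≠ 0)
    (hrest : u p₀.1 p₀.2 = 0)
    (hx0 : fderiv ℝ (u p₀.1) p₀.2 (EuclideanSpace.single 0 1) 2 = 0)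
    (hy1 : fderiv ℝ (u p₀.1) p₀.2 (EuclideanSpace.single 1 1) 2 = 1)
    (hline : ∀ᶠ s in 𝓝 p₀.1, u s p₀.2 = 0) :
    LocalDatumZV (E := ℝ × EuclideanSpace ℝ (Fin 3)) L.length (tableOf L) (maskOf L) dirVec (thHyps L) (thPins L ++ [pinNonUmbilic L])
      (gaugeZerosRSC L) (gaugeValsRS L) := by
  -- as `…THCertGaugeRS.thLocalDatumZV`, plus the nine time-jet point facts
  refine ⟨U, p₀, jetMapOf L u μ A, hU, hp₀, fun _ hq => differentiableAt_jetMapOf hu hμ hA hq,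
    fun j i hi _ hq => tables_jetMapOf hU hu hμ hA j i hi hq, thHyps_vanish hL hU hu hμ hpol hdiv hsh hE, ?_, ?_, ?_⟩
  · intro π hπ
    rcases List.mem_append.1 hπ with h | h
    · exact thPins_ne_zero hL hU hu hμ hp₀ htw hm0 hm1 hmz π h
    · simp only [List.mem_cons, List.mem_nil_iff, or_false] at h
      subst h
      exact pinNonUmbilic_ne_zero hL hu hp₀ hNU
  · intro i hi hlt
    rcases List.mem_append.1 hi with h | h
    · simp only [gaugeZerosRS, gaugeZeros, List.mem_append, List.mem_cons, List.mem_nil_iff, or_false] at h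
      rcases h with (h | h | h) | h
      · rw [jetMapOf_idxOf p₀ _ h hlt, letterFn_W0, hrest]; rfl
      · rw [jetMapOf_idxOf p₀ _ h hlt, letterFn_W0, hrest]; rfl
      · rw [jetMapOf_idxOf p₀ _ h hlt, letterFn_W0, hrest]; rfl
      · rw [jetMapOf_idxOf p₀ _ h hlt, letterFn_Wx hu 2 hp₀, hx0]
    · exact timeZeros_vanish hU hp₀ hu hline h hlt
  · intro iv hiv hlt
    simp only [gaugeValsRS, List.mem_cons, List.mem_nil_iff, or_false] at hiv
    subst hiv
    show jetMapOf L u μ A p₀ ⟨L.idxOf (THLetter.W 2 0 0 1 0), hlt⟩ = ((1 : ℚ) : ℝ)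
    rw [jetMapOf_idxOf p₀ _ rfl hlt, letterFn_Wy hu 2 hp₀, hy1]
    norm_num

end Summit.NavierStokesRegularity.NavierStokesRegularity.Theorems.PoloidalWindowDoorLrcModEntireTHCertGaugeComoving

end
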